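import Mathlib.MeasureTheory.Measure.Lebesgue.VolumeOfBalls
import Mathlib.MeasureTheory.Measure.Haar.InnerProductSpace
import Mathlib.LinearAlgebra.Determinant
import HarnessLib

/-!
# Lattice points of the unit triangular lattice in a disc: `≥ (2/√3)·π·(ρ − 2)²`

HONEST FRAMING. Part of the venture `Summits/Ventures/Crystal3D` (cells `pub-crystal3d`,
`crystal3d-full`). Elementary geometry of numbers; nothing here is about packings.

**Theorem** (`triangular_disc_count`). Let `u = (1, 0)`, `v = (1/2, √3/2)` (the unit triangular
lattice of the close-packed layers `barlowLayer 1 h σ k`, whose point `(i, j)` has in-plane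
coordinates `(i + j/2 + L/2, (√3/2)(j + L/3))`). For every centre `c ∈ ℝ²`, every `ρ ≥ 2` and every
finite set `T ⊆ ℤ²` containing all `(i, j)` with `|i u + j v − c| ≤ ρ`,
`(2/√3)·π·(ρ − 2)² ≤ #T`.

Proof: the parallelograms `(i u + j v) + {s u + t v : 0 ≤ s, t < 1}`, `(i, j) ∈ T`, each of area
`√3/2`, cover the disc of radius `ρ − 2` about `c` (a point `s u + t v` of that disc lies in the
parallelogram of `(⌊s⌋, ⌊t⌋)`, whose corner is within `|u| + |v| = 2` of it), and the disc has area
`π (ρ − 2)²` (`EuclideanSpace.volume_ball_fin_two`).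

Used by the cell `crystal3d-full` to turn the exact layer bound
(`StickySpheres/BarlowLayerBound.lean`) into the basal-facet no-gain inequalities
`2√3·π ρ² − O(ρ) ≤ 6N − C` (`StickySpheres/BarlowAxisNoGain.lean`).

WHAT THIS IS NOT: not the Gauss circle problem (no upper bound, crude `O(ρ)` error).
-/

noncomputable section

namespace Summit.Ventures.Crystal3D

open MeasureTheory Set Finset

/-- **Triangular-lattice disc count.** If `T ⊆ ℤ²` contains every `(i, j)` whose lattice point
`(i + j/2, (√3/2) j)` lies within distance `ρ` of `(c₀, c₁)` (in the form
`(i + j/2 − c₀)² + ((√3/2) j − c₁)² ≤ ρ²`), and `2 ≤ ρ`, then `(2/√3) π (ρ − 2)² ≤ #T`. -/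
theorem triangular_disc_count (c₀ c₁ ρ : ℝ) (hρ : 2 ≤ ρ) (T : Finset (ℤ × ℤ))
    (hT : ∀ i j : ℤ,
      ((i : ℝ) + (j : ℝ) / 2 - c₀) ^ 2 + (Real.sqrt 3 / 2 * (j : ℝ) - c₁) ^ 2 ≤ ρ ^ 2 →
        (i, j) ∈ T) :
    2 / Real.sqrt 3 * Real.pi * (ρ - 2) ^ 2 ≤ (T.card : ℝ) := by
  classical
  have h3 : (0 : ℝ) < Real.sqrt 3 := Real.sqrt_pos.2 (by norm_num)
  have h3sq : Real.sqrt 3 ^ 2 = 3 := Real.sq_sqrt (by norm_num)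
  -- the lattice map `M (s, t) = s u + t v` on `Fin 2 → ℝ`
  set A : Matrix (Fin 2) (Fin 2) ℝ := !![1, 1 / 2; 0, Real.sqrt 3 / 2] with hA
  set M : (Fin 2 → ℝ) →ₗ[ℝ] (Fin 2 → ℝ) := Matrix.toLin' A with hM
  have hM0 : ∀ y : Fin 2 → ℝ, M y 0 = y 0 + y 1 / 2 := by
    intro y
    simp [hM, hA, Matrix.toLin'_apply, Matrix.mulVec, dotProduct, Fin.sum_univ_two]
    ring
  have hM1 : ∀ y : Fin 2 → ℝ, M y 1 = Real.sqrt 3 / 2 * y 1 := by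
    intro y
    simp [hM, hA, Matrix.toLin'_apply, Matrix.mulVec, dotProduct, Fin.sum_univ_two]
  have hdet : LinearMap.det M = Real.sqrt 3 / 2 := by
    rw [hM, LinearMap.det_toLin', hA, Matrix.det_fin_two_of]
    ring
  -- boxes and parallelograms
  set Box : ℤ × ℤ → Set (Fin 2 → ℝ) := fun p =>
    Set.pi Set.univ fun m : Fin 2 =>
      Ico ((![(p.1 : ℝ), (p.2 : ℝ)] : Fin 2 → ℝ) m) ((![(p.1 : ℝ), (p.2 : ℝ)] : Fin 2 → ℝ) m + 1)
    with hBox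
  have hBoxvol : ∀ p, volume (Box p) = 1 := by
    intro p
    rw [hBox]
    simp only
    rw [Real.volume_pi_Ico]
    simp
  have hPvol : ∀ p, volume (M '' Box p) = ENNReal.ofReal (Real.sqrt 3 / 2) := by
    intro p
    rw [MeasureTheory.Measure.addHaar_image_linearMap, hdet, hBoxvol, mul_one,
      abs_of_pos (by positivity)]
  -- the disc of radius `ρ - 2` about `c`, as a subset of `Fin 2 → ℝ`
  set c : Fin 2 → ℝ := ![c₀, c₁] with hc
  set D : Set (Fin 2 → ℝ) :=
    (WithLp.toLp 2 : (Fin 2 → ℝ) → EuclideanSpace ℝ (Fin 2)) ⁻¹'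
      Metric.ball (WithLp.toLp 2 c) (ρ - 2) with hD
  have hDvol : volume D = ENNReal.ofReal (ρ - 2) ^ 2 * ENNReal.ofReal Real.pi := by
    rw [hD, (PiLp.volume_preserving_toLp (Fin 2)).measure_preimage
      measurableSet_ball.nullMeasurableSet, EuclideanSpace.volume_ball_fin_two]
  -- Euclidean distance of two points of `Fin 2 → ℝ` in coordinates
  have hdist : ∀ a b : Fin 2 → ℝ,
      dist (WithLp.toLp 2 a : EuclideanSpace ℝ (Fin 2)) (WithLp.toLp 2 b) =
        Real.sqrt ((a 0 - b 0) ^ 2 + (a 1 - b 1) ^ 2) := by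
    intro a b
    rw [EuclideanSpace.dist_eq, Fin.sum_univ_two]
    simp only [Real.dist_eq, sq_abs]
  -- covering
  have hcover : D ⊆ ⋃ p ∈ T, M '' Box p := by
    intro y hy
    rw [hD, Set.mem_preimage, Metric.mem_ball] at hy
    -- lattice coordinates of `y`
    set t : ℝ := 2 / Real.sqrt 3 * y 1 with ht
    set s : ℝ := y 0 - t / 2 with hs
    set i : ℤ := ⌊s⌋ with hi
    set j : ℤ := ⌊t⌋ with hj
    have hy0 : y 0 = s + t / 2 := by rw [hs]; ring
    have hy1 : y 1 = Real.sqrt 3 / 2 * t := by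
      rw [ht, ← mul_assoc, div_mul_div_comm, mul_comm (Real.sqrt 3) 2, div_self (by positivity),
        one_mul]
    have hsi : (i : ℝ) ≤ s ∧ s < i + 1 := ⟨Int.floor_le s, Int.lt_floor_add_one s⟩
    have htj : (j : ℝ) ≤ t ∧ t < j + 1 := ⟨Int.floor_le t, Int.lt_floor_add_one t⟩
    rw [Set.mem_iUnion₂]
    refine ⟨(i, j), ?_, ?_⟩
    · -- the corner `q = i u + j v` is within `ρ` of `c`
      apply hT
      set q : Fin 2 → ℝ := ![(i : ℝ) + (j : ℝ) / 2, Real.sqrt 3 / 2 * (j : ℝ)] with hq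
      have hq0 : q 0 = (i : ℝ) + (j : ℝ) / 2 := by simp [hq]
      have hq1 : q 1 = Real.sqrt 3 / 2 * (j : ℝ) := by simp [hq]
      have hc0 : c 0 = c₀ := by simp [hc]
      have hc1 : c 1 = c₁ := by simp [hc]
      -- `dist q y ≤ 2`
      have hqy : (q 0 - y 0) ^ 2 + (q 1 - y 1) ^ 2 ≤ 4 := by
        have ha : 0 ≤ s - i ∧ s - i < 1 := ⟨by linarith [hsi.1], by linarith [hsi.2]⟩
        have hb : 0 ≤ t - j ∧ t - j < 1 := ⟨by linarith [htj.1], by linarith [htj.2]⟩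
        have e2 : (q 1 - y 1) ^ 2 = 3 / 4 * (t - j) ^ 2 := by
          rw [hq1, hy1, ← mul_sub, mul_pow, div_pow, h3sq]; ring
        have e1 : (q 0 - y 0) ^ 2 = ((s - i) + (t - j) / 2) ^ 2 := by
          rw [hq0, hy0]; ring
        rw [e1, e2]
        nlinarith [ha.1, ha.2, hb.1, hb.2]
      have hdqy : dist (WithLp.toLp 2 q : EuclideanSpace ℝ (Fin 2)) (WithLp.toLp 2 y) ≤ 2 := by
        rw [hdist]
        calc Real.sqrt ((q 0 - y 0) ^ 2 + (q 1 - y 1) ^ 2) ≤ Real.sqrt 4 :=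
              Real.sqrt_le_sqrt hqy
          _ = 2 := by
              rw [show (4 : ℝ) = 2 ^ 2 by norm_num, Real.sqrt_sq (by norm_num)]
      have hdqc : dist (WithLp.toLp 2 q : EuclideanSpace ℝ (Fin 2)) (WithLp.toLp 2 c) ≤ ρ := by
        have := dist_triangle (WithLp.toLp 2 q : EuclideanSpace ℝ (Fin 2)) (WithLp.toLp 2 y)
          (WithLp.toLp 2 c)
        linarith
      rw [hdist, hq0, hq1, hc0, hc1] at hdqc
      have h0 : 0 ≤ ((i : ℝ) + (j : ℝ) / 2 - c₀) ^ 2 + (Real.sqrt 3 / 2 * (j : ℝ) - c₁) ^ 2 := by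
        positivity
      nlinarith [Real.sq_sqrt h0, Real.sqrt_nonneg
        (((i : ℝ) + (j : ℝ) / 2 - c₀) ^ 2 + (Real.sqrt 3 / 2 * (j : ℝ) - c₁) ^ 2)]
    · -- `y ∈ M '' Box (i, j)`
      refine ⟨![s, t], ?_, ?_⟩
      · rw [hBox, Set.mem_pi]
        intro m _
        fin_cases m
        · simpa using hsi
        · simpa using htj
      · funext m
        fin_cases m
        · simpa [hM0] using hy0.symm
        · simpa [hM1] using hy1.symm
  -- measure comparison
  have hle : volume D ≤ (T.card : ENNReal) * ENNReal.ofReal (Real.sqrt 3 / 2) := by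
    calc volume D ≤ volume (⋃ p ∈ T, M '' Box p) := measure_mono hcover
      _ ≤ ∑ p ∈ T, volume (M '' Box p) := measure_biUnion_finset_le T _
      _ = ∑ p ∈ T, ENNReal.ofReal (Real.sqrt 3 / 2) := sum_congr rfl fun p _ => hPvol p
      _ = (T.card : ENNReal) * ENNReal.ofReal (Real.sqrt 3 / 2) := by
          rw [sum_const, nsmul_eq_mul]
  rw [hDvol] at hle
  have hρ2 : 0 ≤ ρ - 2 := by linarith
  have hle' : ENNReal.ofReal ((ρ - 2) ^ 2 * Real.pi) ≤
      ENNReal.ofReal ((T.card : ℝ) * (Real.sqrt 3 / 2)) := by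
    rw [ENNReal.ofReal_mul (sq_nonneg _), ENNReal.ofReal_pow hρ2,
      ENNReal.ofReal_mul (Nat.cast_nonneg _), ENNReal.ofReal_natCast]
    exact hle
  have hreal := (ENNReal.ofReal_le_ofReal_iff (by positivity)).1 hle'
  rw [div_mul_eq_mul_div, div_mul_eq_mul_div, div_le_iff₀ h3]
  nlinarith [Real.pi_pos]

end Summit.Ventures.Crystal3D

end
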